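import Summits.CriticalPhenomena.PercolationContinuityZ3.Theorems.PercNearOneGluingNoHeavyLowerTailQ44TypedSlicing

/-!
# Two-layer click-intersection families: a tower-free slicing inequality

Support file for crux `stmt-CriticalPhenomena-4575` (master-family programme, quadratic four-point row `Q44`), seat `prim-bnk-1`
gen 24; memo `run/shared/lean/prim/prim-l12/FROM-prim-bnk-1-gen24-TOWER-FREE-RECURSION.md` §2.

`…Q44TypedSlicing` (gen 23) transplanted the Marica–Schönheim / Ahlswede–Daykin slicing induction to typed families: the inner
instance at an element `e` carries VIRTUAL PAIR TYPES, so the type universe squares at every inner step.  This file records the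
observation of gen 24 that the tower is unnecessary once the allowed-difference family is read in INTERSECTION FORM with a
symmetric relation.  A **two-layer family** assigns to every subset `X` of the ground type an ACTIVE type set `A X` and a PASSIVE
type set `P X`; its click-intersection family is
`IQ Q A P = {X ∩ V : some x ∈ A X and y ∈ P V have Q x y}`.
Slicing at `e`: the **outer** family merges the layers of `X` and `insert e X`; the **inner** family keeps, on `X`, the passive layer
of `insert e X` and as active layer the types of `insert e X` SUPPORTED by an active type of `X` (relation `S`, "every `Q`-partner
of the upper type is a `Q`-partner of the lower one") together with the active types of `X` DOMINATED by an active type of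
`insert e X` (relation `D`).  Then (`TwoLayerMS.card_outer_add_card_inner_le`)

  `#IQ Q (outer) + #IQ Q (inner) ≤ #IQ Q A P`,

for ANY symmetric `Q` and any `S`, `D` compatible with `Q` in the stated sense — the type alphabet never changes.  For the 26
oriented `Q44` side types with `Q s t = clickRel s (rev t)` the root family is `A = P = sideTypes ι` and
`TwoLayerMS.ZR_clickRel_eq_IQ` identifies `IQ` with the allowed-difference family `TypedMS.ZR clickRel (sideTypes ι)` of gen 23,
so the inequality is a drop-in engine for `TypedMS.clickCount_iff_ZR`.  The recursion it generates certifies the click count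
`(AC₀)` on every abstract configuration with at most five ground elements (27 688 950 configurations, kit j159029) and on 6 000
random six-element configurations (memo §2–§3); the closed-form invariant is open (memo §4).  No sorries, standard axioms.
-/

namespace Summit.CriticalPhenomena.PercolationContinuityZ3.Theorems

namespace TwoLayerMS

open Finset

variable {γ : Type} [Fintype γ] [DecidableEq γ] {T : Type} [DecidableEq T]

/-- The **click-intersection family** of a two-layer family `(A, P)` under the relation `Q`:
`{X ∩ V : ∃ x ∈ A X, ∃ y ∈ P V, Q x y}`. [this work] -/
def IQ (Q : T → T → Bool) (A P : Finset γ → Finset T) : Finset (Finset γ) :=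
  ((Finset.univ ×ˢ Finset.univ).filter fun p : Finset γ × Finset γ =>
      ∃ x ∈ A p.1, ∃ y ∈ P p.2, Q x y = true).image fun p => p.1 ∩ p.2

omit [DecidableEq T] in
/-- Membership in the click-intersection family. [this work] -/
theorem mem_IQ {Q : T → T → Bool} {A P : Finset γ → Finset T} {S : Finset γ} :
    S ∈ IQ Q A P ↔ ∃ X V : Finset γ, (∃ x ∈ A X, ∃ y ∈ P V, Q x y = true) ∧ X ∩ V = S := by
  unfold IQ
  constructor
  · intro h
    rw [Finset.mem_image] at h
    obtain ⟨p, hp, rfl⟩ := h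
    rw [Finset.mem_filter] at hp
    exact ⟨p.1, p.2, hp.2, rfl⟩
  · rintro ⟨X, V, h, rfl⟩
    rw [Finset.mem_image]
    refine ⟨(X, V), ?_, rfl⟩
    rw [Finset.mem_filter]
    exact ⟨Finset.mem_product.2 ⟨Finset.mem_univ _, Finset.mem_univ _⟩, h⟩

omit [DecidableEq T] in
/-- A witnessed intersection lies in the click-intersection family. [this work] -/
theorem inter_mem_IQ {Q : T → T → Bool} {A P : Finset γ → Finset T} {X V : Finset γ} {x y : T}
    (hx : x ∈ A X) (hy : y ∈ P V) (h : Q x y = true) : X ∩ V ∈ IQ Q A P :=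
  mem_IQ.2 ⟨X, V, ⟨x, hx, y, hy, h⟩, rfl⟩

/-! ## The two slices of `IQ` at an element `e` -/

section slicing

variable (Q : T → T → Bool) (A P : Finset γ → Finset T) (e : γ)

/-- The members of `IQ Q A P` not containing `e`. [this work] -/
def I0 : Finset (Finset γ) := (IQ Q A P).filter fun S => ¬ e ∈ S

/-- The members of `IQ Q A P` containing `e`, with `e` erased. [this work] -/
def I1 : Finset (Finset γ) := ((IQ Q A P).filter fun S => e ∈ S).image fun S => S.erase e

omit [DecidableEq T] in
/-- `#I0 + #I1 = #IQ`. [this work] -/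
theorem card_I0_add_card_I1 : #(I0 Q A P e) + #(I1 Q A P e) = #(IQ Q A P) := by
  unfold I0 I1
  rw [Finset.card_image_of_injOn, add_comm]
  · exact Finset.card_filter_add_card_filter_not (s := IQ Q A P) (fun S => e ∈ S)
  · intro S hS S' hS' h
    rw [Finset.coe_filter] at hS hS'
    have h0 : S.erase e = S'.erase e := h
    have h1 : insert e (S.erase e) = insert e (S'.erase e) := by rw [h0]
    rwa [Finset.insert_erase hS.2, Finset.insert_erase hS'.2] at h1

variable {Q A P e}

omit [DecidableEq T] in
/-- Membership in `I0`. [this work] -/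
theorem mem_I0_iff {S : Finset γ} : S ∈ I0 Q A P e ↔ S ∈ IQ Q A P ∧ e ∉ S := by
  unfold I0; rw [Finset.mem_filter]

omit [DecidableEq T] in
/-- If `insert e S ∈ IQ` and `e ∉ S` then `S ∈ I1`. [this work] -/
theorem mem_I1_of_insert {S : Finset γ} (h : insert e S ∈ IQ Q A P) (hS : e ∉ S) : S ∈ I1 Q A P e := by
  unfold I1
  rw [Finset.mem_image]
  refine ⟨insert e S, ?_, Finset.erase_insert hS⟩
  rw [Finset.mem_filter]
  exact ⟨h, Finset.mem_insert_self _ _⟩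

omit [Fintype γ] in
/-- `X ∩ insert e V = X ∩ V` when `e ∉ X`. [folklore] -/
theorem inter_insert_of_not_mem {X V : Finset γ} (hX : e ∉ X) : X ∩ insert e V = X ∩ V := by
  rw [Finset.inter_insert_of_notMem hX]

omit [Fintype γ] in
/-- `insert e X ∩ V = X ∩ V` when `e ∉ V`. [folklore] -/
theorem insert_inter_of_not_mem {X V : Finset γ} (hV : e ∉ V) : insert e X ∩ V = X ∩ V := by
  rw [Finset.insert_inter_of_notMem hV]

omit [Fintype γ] in
/-- `insert e X ∩ insert e V = insert e (X ∩ V)`. [folklore] -/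
theorem insert_inter_insert_eq (X V : Finset γ) : insert e X ∩ insert e V = insert e (X ∩ V) := by
  rw [Finset.insert_inter_distrib]

omit [Fintype γ] in
/-- `e ∉ X ∩ V` when `e ∉ X`. [folklore] -/
theorem not_mem_inter_of_left {X V : Finset γ} (hX : e ∉ X) : e ∉ X ∩ V := by
  rw [Finset.mem_inter]; exact fun hh => hX hh.1

/-! ## Outer (merge) and inner (support / domination) families -/

variable (A P e)

/-- The **outer active layer** at `e`: `A X ∪ A (insert e X)` on sets not containing `e`. [this work] -/
def outerA : Finset γ → Finset T := fun X => if e ∈ X then ∅ else A X ∪ A (insert e X)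

/-- The **outer passive layer** at `e`: `P X ∪ P (insert e X)` on sets not containing `e`. [this work] -/
def outerP : Finset γ → Finset T := fun X => if e ∈ X then ∅ else P X ∪ P (insert e X)

variable (S D : T → T → Bool)

/-- The active types of `X` DOMINATED (relation `D`) by some active type of `insert e X`. [this work] -/
def domPart : Finset γ → Finset T :=
  fun X => (A X).filter fun a₀ => ∃ a₁ ∈ A (insert e X), D a₀ a₁ = true

/-- The **inner active layer** at `e`: the active types of `insert e X` SUPPORTED (relation `S`) by some active type of `X`,
together with `domPart`. [this work] -/
def innerA : Finset γ → Finset T := fun X =>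
  if e ∈ X then ∅ else
    ((A (insert e X)).filter fun a₁ => ∃ a₀ ∈ A X, S a₀ a₁ = true) ∪ domPart A e D X

/-- The **inner passive layer** at `e`: `P (insert e X) ∪ domPart`. [this work] -/
def innerP : Finset γ → Finset T := fun X => if e ∈ X then ∅ else P (insert e X) ∪ domPart A e D X

variable {A P e S D}

/-- **Outer ⊆ I0 ∪ I1**: a click intersection of the merged family is a click intersection of `(A,P)` with the same trace
outside `e`. [this work] -/
theorem IQ_outer_subset : IQ Q (outerA A e) (outerP P e) ⊆ I0 Q A P e ∪ I1 Q A P e := by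
  intro W hW
  rw [mem_IQ] at hW
  obtain ⟨X, V, ⟨x, hx, y, hy, h⟩, rfl⟩ := hW
  unfold outerA at hx
  unfold outerP at hy
  by_cases hX : e ∈ X
  · rw [if_pos hX] at hx; exact absurd hx (Finset.notMem_empty _)
  by_cases hV : e ∈ V
  · rw [if_pos hV] at hy; exact absurd hy (Finset.notMem_empty _)
  rw [if_neg hX, Finset.mem_union] at hx
  rw [if_neg hV, Finset.mem_union] at hy
  rw [Finset.mem_union]
  rcases hx with hx | hx
  · rcases hy with hy | hy
    · exact Or.inl (mem_I0_iff.2 ⟨inter_mem_IQ hx hy h, not_mem_inter_of_left hX⟩)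
    · left
      have h1 := inter_mem_IQ (Q := Q) (A := A) (P := P) hx hy h
      rw [inter_insert_of_not_mem hX] at h1
      exact mem_I0_iff.2 ⟨h1, not_mem_inter_of_left hX⟩
  · rcases hy with hy | hy
    · left
      have h1 := inter_mem_IQ (Q := Q) (A := A) (P := P) hx hy h
      rw [insert_inter_of_not_mem hV] at h1
      exact mem_I0_iff.2 ⟨h1, not_mem_inter_of_left hX⟩
    · right
      have h1 := inter_mem_IQ (Q := Q) (A := A) (P := P) hx hy h
      rw [insert_inter_insert_eq] at h1
      exact mem_I1_of_insert h1 (not_mem_inter_of_left hX)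

/-- **Inner ⊆ I0 ∩ I1** under the compatibility hypotheses: `S a₀ a₁` makes every `Q`-partner of `a₁` a `Q`-partner of `a₀`,
`D a₀ a₁` makes every `Q`-partner of `a₀` a `Q`-partner of `a₁`, and `Q` is symmetric.  Every click intersection of the inner
family is then realised once by the two `e`-containing sets (giving `I1`) and once with at most one of them (giving `I0`). [this work] -/
theorem IQ_inner_subset (hQ : ∀ a b, Q a b = Q b a) (hAP : ∀ X, A X ⊆ P X)
    (hS : ∀ a₀ a₁, S a₀ a₁ = true → ∀ c, Q a₁ c = true → Q a₀ c = true)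
    (hD : ∀ a₀ a₁, D a₀ a₁ = true → ∀ c, Q a₀ c = true → Q a₁ c = true) :
    IQ Q (innerA A e S D) (innerP A P e D) ⊆ I0 Q A P e ∩ I1 Q A P e := by
  intro W hW
  rw [mem_IQ] at hW
  obtain ⟨X, V, ⟨x, hx, y, hy, h⟩, rfl⟩ := hW
  unfold innerA at hx
  unfold innerP at hy
  by_cases hX : e ∈ X
  · rw [if_pos hX] at hx; exact absurd hx (Finset.notMem_empty _)
  by_cases hV : e ∈ V
  · rw [if_pos hV] at hy; exact absurd hy (Finset.notMem_empty _)
  rw [if_neg hX, Finset.mem_union] at hx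
  rw [if_neg hV, Finset.mem_union] at hy
  -- the two membership goals follow from a realisation WITH `e` on both sets and one WITHOUT `e` on at least one set
  have goal_of : (insert e X ∩ insert e V ∈ IQ Q A P) →
      (X ∩ V ∈ IQ Q A P) → X ∩ V ∈ I0 Q A P e ∩ I1 Q A P e := by
    intro h11 h0
    rw [Finset.mem_inter]
    refine ⟨mem_I0_iff.2 ⟨h0, not_mem_inter_of_left hX⟩, ?_⟩
    rw [insert_inter_insert_eq] at h11
    exact mem_I1_of_insert h11 (not_mem_inter_of_left hX)
  -- `X ∩ insert e V = X ∩ V` and `insert e X ∩ V = X ∩ V`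
  have eqXV : X ∩ insert e V = X ∩ V := inter_insert_of_not_mem hX
  have eqXV' : insert e X ∩ V = X ∩ V := insert_inter_of_not_mem hV
  rcases hx with hx | hx
  · -- x = a₁ ∈ A (insert e X), supported by some a₀ ∈ A X
    rw [Finset.mem_filter] at hx
    obtain ⟨hx1, a₀, ha₀, hSa⟩ := hx
    rcases hy with hy | hy
    · -- y ∈ P (insert e V)
      refine goal_of (inter_mem_IQ hx1 hy h) ?_
      have h0 := inter_mem_IQ (Q := Q) (A := A) (P := P) (X := X) (V := insert e V) ha₀ hy (hS a₀ x hSa y h)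
      rwa [eqXV] at h0
    · -- y = c₀ ∈ A V dominated by some c₁ ∈ A (insert e V)
      unfold domPart at hy
      rw [Finset.mem_filter] at hy
      obtain ⟨hy0, c₁, hc₁, hDc⟩ := hy
      refine goal_of ?_ ?_
      · -- with e: Q x c₁ from Q x c₀ by domination (via symmetry)
        have hq : Q x c₁ = true := by
          rw [hQ]; exact hD y c₁ hDc x (by rw [hQ]; exact h)
        exact inter_mem_IQ hx1 (hAP _ hc₁) hq
      · -- without e on V: insert e X ∩ V = X ∩ V
        have h0 := inter_mem_IQ (Q := Q) (A := A) (P := P) (X := insert e X) (V := V) hx1 (hAP _ hy0) h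
        rwa [eqXV'] at h0
  · -- x = a₀ ∈ A X dominated by some a₁ ∈ A (insert e X)
    unfold domPart at hx
    rw [Finset.mem_filter] at hx
    obtain ⟨hx0, a₁, ha₁, hDa⟩ := hx
    rcases hy with hy | hy
    · -- y ∈ P (insert e V)
      refine goal_of (inter_mem_IQ ha₁ hy (hD x a₁ hDa y h)) ?_
      have h0 := inter_mem_IQ (Q := Q) (A := A) (P := P) (X := X) (V := insert e V) hx0 hy h
      rwa [eqXV] at h0
    · -- y = c₀ ∈ A V dominated by some c₁ ∈ A (insert e V)
      unfold domPart at hy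
      rw [Finset.mem_filter] at hy
      obtain ⟨hy0, c₁, hc₁, hDc⟩ := hy
      refine goal_of ?_ (inter_mem_IQ hx0 (hAP _ hy0) h)
      -- with e: Q a₁ c₁ from Q a₀ c₀ by two dominations
      have h1 : Q a₁ y = true := hD x a₁ hDa y h
      have h2 : Q c₁ a₁ = true := hD y c₁ hDc a₁ (by rw [hQ]; exact h1)
      have h3 : Q a₁ c₁ = true := by rw [hQ]; exact h2
      exact inter_mem_IQ ha₁ (hAP _ hc₁) h3

variable (Q A P e S D)

/-- **The tower-free slicing inequality for two-layer families**:
`#IQ Q outer + #IQ Q inner ≤ #IQ Q A P` (memo §2; `Q` symmetric, `A ⊆ P`, `S`/`D` compatible with `Q`). [this work] -/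
theorem card_outer_add_card_inner_le (hQ : ∀ a b, Q a b = Q b a) (hAP : ∀ X, A X ⊆ P X)
    (hS : ∀ a₀ a₁, S a₀ a₁ = true → ∀ c, Q a₁ c = true → Q a₀ c = true)
    (hD : ∀ a₀ a₁, D a₀ a₁ = true → ∀ c, Q a₀ c = true → Q a₁ c = true) :
    #(IQ Q (outerA A e) (outerP P e)) + #(IQ Q (innerA A e S D) (innerP A P e D)) ≤ #(IQ Q A P) := by
  calc #(IQ Q (outerA A e) (outerP P e)) + #(IQ Q (innerA A e S D) (innerP A P e D))
      ≤ #(I0 Q A P e ∪ I1 Q A P e) + #(I0 Q A P e ∩ I1 Q A P e) :=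
        Nat.add_le_add (Finset.card_le_card IQ_outer_subset)
          (Finset.card_le_card (IQ_inner_subset hQ hAP hS hD))
    _ = #(I0 Q A P e) + #(I1 Q A P e) := Finset.card_union_add_card_inter _ _
    _ = #(IQ Q A P) := card_I0_add_card_I1 Q A P e

omit [Fintype γ] in
/-- The layer inclusion `A ⊆ P` is inherited by the outer family. [this work] -/
theorem outerA_subset_outerP (hAP : ∀ X, A X ⊆ P X) (X : Finset γ) : outerA A e X ⊆ outerP P e X := by
  unfold outerA outerP
  by_cases hX : e ∈ X
  · rw [if_pos hX, if_pos hX]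
  · rw [if_neg hX, if_neg hX]
    exact Finset.union_subset_union (hAP X) (hAP (insert e X))

omit [Fintype γ] in
/-- The layer inclusion `A ⊆ P` is inherited by the inner family. [this work] -/
theorem innerA_subset_innerP (hAP : ∀ X, A X ⊆ P X) (X : Finset γ) :
    innerA A e S D X ⊆ innerP A P e D X := by
  unfold innerA innerP
  by_cases hX : e ∈ X
  · rw [if_pos hX, if_pos hX]
  · rw [if_neg hX, if_neg hX]
    refine Finset.union_subset_union ?_ (subset_refl _)
    exact (Finset.filter_subset _ _).trans (hAP (insert e X))

omit [Fintype γ] [DecidableEq γ] [DecidableEq T] in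
/-- The canonical choice `S a₀ a₁ := "every Q-partner of a₁ is a Q-partner of a₀"` (Q-row inclusion) satisfies the support
hypothesis, and dually for `D`; stated for a finite type alphabet. [this work] -/
theorem rowIncl_support [Fintype T] {Q : T → T → Bool} (a₀ a₁ : T)
    (h : decide (∀ c, Q a₁ c = true → Q a₀ c = true) = true) : ∀ c, Q a₁ c = true → Q a₀ c = true :=
  of_decide_eq_true h

end slicing

/-! ## The root: the allowed-difference family of gen 23 in intersection form -/

section click

open TwoCopyMono TypedMS

/-- The click relation in intersection form: `clickQ s t := clickRel s (rev t)` where `rev (x, y) = (y, x)`;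
`X ∩ V` is a co-click-union iff `clickQ (ι X, ι Xᶜ) (ι V, ι Vᶜ)`. [this work] -/
def clickQ : Fin 15 × Fin 15 → Fin 15 × Fin 15 → Bool := fun s t => clickRel s (t.2, t.1)

/-- `clickQ` is symmetric (it reads `upAC s.2 t.2 ∧ downBot s.1 t.1`, and both predicates are symmetric). [this work] -/
theorem clickQ_symm (s t : Fin 15 × Fin 15) : clickQ s t = clickQ t s := by
  unfold clickQ clickRel
  have hup : ∀ h l : Fin 15, upAC h l = upAC l h := by decide
  have hdown : ∀ h l : Fin 15, downBot h l = downBot l h := by decide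
  simp only
  rw [hup s.2 t.2, hdown s.1 t.1]

/-- **The allowed-difference family of gen 23 is the click-intersection family of the two-layer root**
`A = P = sideTypes ι`: `ZR clickRel (sideTypes ι) = IQ clickQ (sideTypes ι) (sideTypes ι)` (use `X \ Y = X ∩ Yᶜ` and
`sideTypes ι Yᶜ = rev (sideTypes ι Y)`). [this work] -/
theorem ZR_clickRel_eq_IQ (ι : Finset γ → Fin 15) :
    ZR clickRel (sideTypes ι) = IQ clickQ (sideTypes ι) (sideTypes ι) := by
  ext W
  rw [mem_ZR, mem_IQ]
  constructor
  · rintro ⟨X, Y, ⟨t, ht, s, hs, h⟩, rfl⟩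
    unfold sideTypes at ht hs
    rw [Finset.mem_singleton] at ht hs
    subst ht; subst hs
    refine ⟨X, Yᶜ, ⟨(ι X, ι Xᶜ), ?_, (ι Yᶜ, ι Yᶜᶜ), ?_, ?_⟩, ?_⟩
    · unfold sideTypes; exact Finset.mem_singleton_self _
    · unfold sideTypes; exact Finset.mem_singleton_self _
    · unfold clickQ; rw [compl_compl]; exact h
    · rw [Finset.sdiff_eq_inter_compl]
  · rintro ⟨X, V, ⟨x, hx, y, hy, h⟩, rfl⟩
    unfold sideTypes at hx hy
    rw [Finset.mem_singleton] at hx hy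
    subst hx; subst hy
    refine ⟨X, Vᶜ, ⟨(ι X, ι Xᶜ), ?_, (ι Vᶜ, ι Vᶜᶜ), ?_, ?_⟩, ?_⟩
    · unfold sideTypes; exact Finset.mem_singleton_self _
    · unfold sideTypes; exact Finset.mem_singleton_self _
    · unfold clickQ at h; rw [compl_compl]; exact h
    · rw [Finset.sdiff_eq_inter_compl, compl_compl]

/-- Hence the click count `(AC₀)` is the statement `#B + #D ≤ 2 · #IQ clickQ (sideTypes ι) (sideTypes ι)` about the
two-layer root, to which `card_outer_add_card_inner_le` applies with the same 26-type alphabet at every depth. [this work] -/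
theorem card_ZR_clickRel_eq (ι : Finset γ → Fin 15) :
    #(ZR clickRel (sideTypes ι)) = #(IQ clickQ (sideTypes ι) (sideTypes ι)) := by
  rw [ZR_clickRel_eq_IQ]

end click

end TwoLayerMS

end Summit.CriticalPhenomena.PercolationContinuityZ3.Theorems
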